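import Mathlib
import Literature.NumberTheory.Irrationality.Brown2016.DinnerParties
import Summits.KontsevichZagierPeriods.Zeta5Search.Families.CellularIntegral
import Summits.KontsevichZagierPeriods.Zeta5Search.Families.BasicConvergence
import Summits.KontsevichZagierPeriods.Zeta5Search.Families.ChordCrossings
import Summits.KontsevichZagierPeriods.Zeta5Search.Families.BasicConvergenceGeneral
import HarnessLib

/-!
# ζ(5) search — Families: convergence of a seating is invariant under the two dihedral groups and under duality

HONEST FRAMING: systematic search; no irrationality claim unless certified.

Cell `pub-zeta5`, seat P2.  Brown's configurations are the classes of seatings `σ : ℤ/n → ℤ/n` modulo the dihedral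
symmetries of the source `n`-gon (rotating / reflecting the positions) and of the target (rotating / reflecting the
places), and duality `[σ]^∨ = [σ⁻¹]` [Brown2016, §1.5, §3.1 (3.4)–(3.5), Def. 3.2].  The cell's enumerations
(`Configurations*.lean`) certify convergence for one representative per class by kernel evaluation; this file
proves once and for all that `Convergent` (`Families/BasicConvergenceGeneral.lean`) is a CLASS INVARIANT:
* `convergent_comp_add_iff`, `convergent_comp_sub_iff` — rotations / reflections `i ↦ i + c`, `i ↦ c − i` of the
  positions; `convergent_add_iff`, `convergent_sub_iff` — of the places;
* `convergent_symm_iff` — **duality**: a bijective seating is convergent iff its inverse is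
  (`windowInBlock_symm`: a window seated into a block of the same size is seated ONTO it);
* `brownConvergent_basic_symm_iff` — hence Brown's convergence condition for the basic integrand of `σ⁻¹`
  (`N ≥ 0`) is that of `σ` [Brown2016, Lemma 3.6 with `(δ,δ')^∨ = (δ',δ)`].
Arc bookkeeping: `add_mem_arc_add_iff`, `sub_mem_arc_iff` (a reflection maps the arc `{c−a−(k−1),…,c−a}` onto
`{a,…,a+k−1}`), `mem_arc_iff_exists'`.  The scoped `ℕ → Fin` cast / ring structure are opened in proofs and in the
statements of the internal window lemmas only.
-/
namespace Summit.KontsevichZagierPeriods.Zeta5Search.Families.Cellular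

open Finset

variable {ℓ : ℕ}

section Symmetries

open Fin.NatCast Fin.CommRing

/-- Membership in an arc in additive form (any `k`): `y ∈ arc a k` iff `y = a + m` with `m < k` and `m < n`. -/
theorem mem_arc_iff_exists' {a y : Fin (ℓ + 3)} {k : ℕ} :
    y ∈ arc a k ↔ ∃ m : ℕ, m < k ∧ m < ℓ + 3 ∧ y = a + (m : Fin (ℓ + 3)) := by
  rw [mem_arc]
  constructor
  · intro h
    exact ⟨_, h, Fin.isLt _, by rw [Fin.cast_val_eq_self, add_sub_cancel]⟩
  · rintro ⟨m, hm, hmn, rfl⟩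
    rw [add_sub_cancel_left, Fin.val_cast_of_lt hmn]
    exact hm

/-- Rotating: `v + c ∈ arc (s + c) k ↔ v ∈ arc s k`. -/
theorem add_mem_arc_add_iff (s v c : Fin (ℓ + 3)) (k : ℕ) : v + c ∈ arc (s + c) k ↔ v ∈ arc s k := by
  simp only [mem_arc, add_sub_add_right_eq_sub]

/-- Reflecting: `c − v ∈ arc a k ↔ v ∈ arc (c − a − (k−1)) k` (the reflection `v ↦ c − v` maps the arc
`{c−a−(k−1), …, c−a}` onto `{a, …, a+k−1}`). -/
theorem sub_mem_arc_iff (a v c : Fin (ℓ + 3)) {k : ℕ} (h1 : 1 ≤ k) (hk : k ≤ ℓ + 3) :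
    c - v ∈ arc a k ↔ v ∈ arc (c - a - ((k - 1 : ℕ) : Fin (ℓ + 3))) k := by
  rw [mem_arc_iff_exists', mem_arc_iff_exists']
  constructor
  · rintro ⟨m, hm, hmn, h⟩
    refine ⟨k - 1 - m, by omega, by omega, ?_⟩
    rw [Nat.cast_sub (show m ≤ k - 1 by omega)]
    linear_combination (-1 : Fin (ℓ + 3)) * h
  · rintro ⟨m, hm, hmn, h⟩
    refine ⟨k - 1 - m, by omega, by omega, ?_⟩
    rw [Nat.cast_sub (show m ≤ k - 1 by omega)]
    linear_combination (-1 : Fin (ℓ + 3)) * h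

/-- Rotating the POSITIONS (`σ ↦ σ ∘ (· + c)`) moves windows: block condition at `s` ↔ at `s + c`. -/
theorem windowInBlock_comp_add_iff (σ : Fin (ℓ + 3) → Fin (ℓ + 3)) (c s : Fin (ℓ + 3)) (k : ℕ) :
    WindowInBlock (fun i => σ (i + c)) s k ↔ WindowInBlock σ (s + c) k := by
  unfold WindowInBlock
  refine exists_congr fun a => ⟨fun h i hi => ?_, fun h i hi => ?_⟩
  · have := h (i - c) (by rw [← add_mem_arc_add_iff s (i - c) c k, sub_add_cancel]; exact hi)
    simpa using this
  · exact h (i + c) ((add_mem_arc_add_iff s i c k).2 hi)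

/-- Rotating the PLACES (`σ ↦ σ + c`) does not change the block condition. -/
theorem windowInBlock_add_iff (σ : Fin (ℓ + 3) → Fin (ℓ + 3)) (c s : Fin (ℓ + 3)) (k : ℕ) :
    WindowInBlock (fun i => σ i + c) s k ↔ WindowInBlock σ s k := by
  unfold WindowInBlock
  constructor
  · rintro ⟨a, ha⟩
    refine ⟨a - c, fun i hi => ?_⟩
    rw [← add_mem_arc_add_iff (a - c) (σ i) c, sub_add_cancel]
    exact ha i hi
  · rintro ⟨a, ha⟩
    exact ⟨a + c, fun i hi => (add_mem_arc_add_iff a (σ i) c k).2 (ha i hi)⟩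

/-- Reflecting the POSITIONS (`σ ↦ σ ∘ (c − ·)`): block condition at `s` ↔ at the reflected window start. -/
theorem windowInBlock_comp_sub_iff (σ : Fin (ℓ + 3) → Fin (ℓ + 3)) (c s : Fin (ℓ + 3)) {k : ℕ} (h1 : 1 ≤ k)
    (hk : k ≤ ℓ + 3) :
    WindowInBlock (fun i => σ (c - i)) s k ↔ WindowInBlock σ (c - s - ((k - 1 : ℕ) : Fin (ℓ + 3))) k := by
  unfold WindowInBlock
  refine exists_congr fun a => ⟨fun h i hi => ?_, fun h i hi => ?_⟩
  · have := h (c - i) ((sub_mem_arc_iff s i c h1 hk).2 hi)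
    simpa using this
  · refine h (c - i) ((sub_mem_arc_iff s (c - i) c h1 hk).1 ?_)
    rw [sub_sub_cancel]
    exact hi

/-- Reflecting the PLACES (`σ ↦ c − σ`) does not change the block condition. -/
theorem windowInBlock_sub_iff (σ : Fin (ℓ + 3) → Fin (ℓ + 3)) (c s : Fin (ℓ + 3)) {k : ℕ} (h1 : 1 ≤ k)
    (hk : k ≤ ℓ + 3) : WindowInBlock (fun i => c - σ i) s k ↔ WindowInBlock σ s k := by
  unfold WindowInBlock
  constructor
  · rintro ⟨a, ha⟩
    exact ⟨_, fun i hi => (sub_mem_arc_iff a (σ i) c h1 hk).1 (ha i hi)⟩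
  · rintro ⟨a, ha⟩
    refine ⟨c - a - ((k - 1 : ℕ) : Fin (ℓ + 3)), fun i hi => ?_⟩
    rw [sub_mem_arc_iff _ (σ i) c h1 hk]
    have : c - (c - a - ((k - 1 : ℕ) : Fin (ℓ + 3))) - ((k - 1 : ℕ) : Fin (ℓ + 3)) = a := by abel
    rw [this]
    exact ha i hi

/-- DUALITY: if a bijection seats the window `{s,…,s+k−1}` into the block `{a,…,a+k−1}` (`k ≤ n`), it does so
ONTO, and the inverse bijection seats the window `{a,…}` into the block `{s,…}`. [Brown2016, Def. 3.2
(`(δ,δ')^∨ = (δ',δ)`), §3.1] -/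
theorem windowInBlock_symm (e : Equiv.Perm (Fin (ℓ + 3))) {s : Fin (ℓ + 3)} {k : ℕ} (hk : k ≤ ℓ + 3)
    (h : WindowInBlock e s k) : ∃ a : Fin (ℓ + 3), WindowInBlock e.symm a k := by
  obtain ⟨a, ha⟩ := h
  refine ⟨a, s, fun v hv => ?_⟩
  -- the image of the window is the whole block (same cardinality)
  have himg : (arc s k).image e = arc a k := by
    apply eq_of_subset_of_card_le
    · intro w hw
      rw [mem_image] at hw
      obtain ⟨i, hi, rfl⟩ := hw
      exact ha i hi
    · rw [card_image_of_injective _ e.injective, card_arc _ hk, card_arc _ hk]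
  rw [← himg, mem_image] at hv
  obtain ⟨i, hi, rfl⟩ := hv
  simpa using hi

end Symmetries

/-! ### Convergence is invariant under the two dihedral groups and under duality -/

/-- `Convergent` is invariant under rotation of the positions. [Brown2016, §3.1 (3.4)] -/
theorem convergent_comp_add_iff (σ : Fin (ℓ + 3) → Fin (ℓ + 3)) (c : Fin (ℓ + 3)) :
    Convergent (fun i => σ (i + c)) ↔ Convergent σ := by
  unfold Convergent
  constructor
  · intro h s k hk hk2
    have := h (s - c) k hk hk2
    rwa [windowInBlock_comp_add_iff, sub_add_cancel] at this
  · intro h s k hk hk2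
    rw [windowInBlock_comp_add_iff]
    exact h _ k hk hk2

/-- `Convergent` is invariant under rotation of the places. [Brown2016, §3.1 (3.5)] -/
theorem convergent_add_iff (σ : Fin (ℓ + 3) → Fin (ℓ + 3)) (c : Fin (ℓ + 3)) :
    Convergent (fun i => σ i + c) ↔ Convergent σ := by
  unfold Convergent
  simp only [windowInBlock_add_iff]

section Reflect

open Fin.NatCast Fin.CommRing

/-- `Convergent` is invariant under reflection of the positions `i ↦ c − i`. [Brown2016, §3.1 (3.4)] -/
theorem convergent_comp_sub_iff (σ : Fin (ℓ + 3) → Fin (ℓ + 3)) (c : Fin (ℓ + 3)) :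
    Convergent (fun i => σ (c - i)) ↔ Convergent σ := by
  unfold Convergent
  constructor
  · intro h s k hk hk2
    have := h (c - s - ((k - 1 : ℕ) : Fin (ℓ + 3))) k hk hk2
    rwa [windowInBlock_comp_sub_iff σ c _ (by omega) (by omega),
      show c - (c - s - ((k - 1 : ℕ) : Fin (ℓ + 3))) - ((k - 1 : ℕ) : Fin (ℓ + 3)) = s by abel] at this
  · intro h s k hk hk2
    rw [windowInBlock_comp_sub_iff σ c s (by omega) (by omega)]
    exact h _ k hk hk2

end Reflect

/-- `Convergent` is invariant under reflection of the places `v ↦ c − v`. [Brown2016, §3.1 (3.5)] -/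
theorem convergent_sub_iff (σ : Fin (ℓ + 3) → Fin (ℓ + 3)) (c : Fin (ℓ + 3)) :
    Convergent (fun i => c - σ i) ↔ Convergent σ := by
  unfold Convergent
  refine forall_congr' fun s => forall_congr' fun k => forall_congr' fun hk => forall_congr' fun hk2 => ?_
  rw [windowInBlock_sub_iff σ c s (by omega) (by omega)]

/-- **Duality** `[σ]^∨ = [σ⁻¹]` preserves convergence: a bijective seating is convergent iff its inverse is.
[Brown2016, Def. 3.2, §3.1; cf. the kernel-checked duality tables `Configurations.dual_reps9`] -/
theorem convergent_symm_iff (e : Equiv.Perm (Fin (ℓ + 3))) : Convergent e.symm ↔ Convergent e := by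
  constructor
  · intro h s k hk hk2 hw
    obtain ⟨a, ha⟩ := windowInBlock_symm e (by omega) hw
    exact h a k hk hk2 ha
  · intro h s k hk hk2 hw
    obtain ⟨a, ha⟩ := windowInBlock_symm e.symm (by omega) hw
    rw [Equiv.symm_symm] at ha
    exact h a k hk hk2 ha

/-- Hence, for a bijective seating and `N ≥ 0`, Brown's convergence condition for the basic cellular integrand is
invariant under both dihedral groups and under duality — e.g. under inversion. [Brown2016, §3.1, Lemma 3.6] -/
theorem brownConvergent_basic_symm_iff (e : Equiv.Perm (Fin (ℓ + 3))) {N : ℤ} (hN : 0 ≤ N) :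
    BrownConvergent e.symm (fun _ => N) (fun _ => N) ↔ BrownConvergent e (fun _ => N) (fun _ => N) := by
  rw [brownConvergent_basic_iff_convergent e.symm.bijective hN, brownConvergent_basic_iff_convergent e.bijective hN,
    convergent_symm_iff]

/-- Sanity check (kernel): the Brown–Zudilin plan and its inverse plan are both convergent. -/
example : Convergent (ofSeating (ℓ := 5) [8, 2, 4, 1, 7, 5, 3, 6]) ∧
    Convergent (ofSeating (ℓ := 5) [4, 2, 7, 3, 6, 8, 5, 1]) := by decide

end Summit.KontsevichZagierPeriods.Zeta5Search.Families.Cellular
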